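import Summits.HodgeConjecture.CorCM.IrreducibleOddWeightsSubfamilyDomination
import Summits.HodgeConjecture.CorCM.IrreducibleOddWeightsCommutantSigmaPivot
import HarnessLib

/-!
# Sub-family domination, III: A WHOLE FAMILY IN ONE ISOTYPIC CLASS — `(rank Σ − 1)·δ = dim(⨆_{i,j} D·b^i_j)·dim A`,
# `rank Σ = rank Σ_κ ⟺ ∀ i, D⟨b^i⟩ ≤ ⨆_j D⟨b^{κ j}⟩`, additivity ⟺ the D-spans `D⟨b^i⟩` are INDEPENDENT

COR-CM (cell `pub-hodgecm2`, binder seat `b16` gen 74, count-neutral claim SUB-FAMILY DOMINATION AND HODGE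
EQUIVALENCE, file S4 — abstract `G`-set level and type ranks; theorems only, no definition, no named fact, no
`sorry`).  NEW as stated, hence under `Summits/`.  HONEST FRAMING: finite-dimensional linear algebra about the
Kubota–Dodson rank of a family of CM types (`rank Σ − 1 = dim Hg(∏_i A_i)`); nothing about Hodge classes is asserted,
`HC_CM` is neither used nor asserted.

SETTING.  A family `Φ_i ⊆ E_i` (`i ∈ I`) of CM types whose type vectors ALL come from ONE reference `G`-stable
irreducible `A ≤ ℚ^Y` (commutant `𝒟`, ANY): `u_i = Σ_j ι^i_j(b^i_j)` for equivariant embeddings `ι^i_j : A → ℚ^{E_i}`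
jointly independent on `A`, `b^i_j ∈ A` — the family lies in ONE ISOTYPIC CLASS.  `D⟨b^i⟩ = ⨆_j D·b^i_j`, `δ = dim D·a₀`.
Gen 56 F3 `…DRank` is the same-slot, definition-free count `dim U(Σ) = t·dim A`; gen 72 C5 / gen 73 K3–K5 are two
slots; file S3 supplies the juxtaposition of all the Galois pivots `E_i`.

* §1 `iSup_span_coeff_eq_iSup_span_shadowCoeff_of_eq` (`⨆_i MC_i = ⨆_i S(u_i)`); family against family
  `finrank_iSup_span_shadowCoeff_inf_iSup_mul_eq`.
* §2 **`typeRank_sigmaType_mul_eq_of_class`: `rank Σ·δ = δ + dim(⨆_i D⟨b^i⟩)·dim A`** (`dim Hg(∏_i A_i)·δ = dim(D-span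
  of ALL the components)·dim A`), D-rank form `exists_rank_typeRank_sigmaType_eq_of_class`; THE FAMILY DEFECT
  `typeRank_sigmaType_add_card_mul_add_eq_of_class` and **ADDITIVITY `typeRank_sigmaType_add_card_eq_iff_iSupIndep_of_class`:
  `Hg(∏_i A_i) = ∏_i Hg(A_i) ⟺ the D-spans D⟨b^i⟩ are INDEPENDENT in A`**.
* §3 SUB-FAMILIES: **`typeRank_sigmaType_eq_reindex_iff_forall_iSup_le_of_class`: `rank Σ = rank Σ_κ ⟺ ∀ i, D⟨b^i⟩ ≤
  ⨆_j D⟨b^{κ j}⟩`**, `…_iff_iSup_eq_of_class`, the excess `typeRank_sigmaType_reindex_mul_add_eq_of_class`; two blocks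
  `typeRank_sigmaType_add_mul_eq_of_union_of_class`; all but one `typeRank_sigmaType_eq_iff_iSup_le_of_erase_of_class`.

## References

* [Deligne1982HodgeCycles] P. Deligne, *Hodge cycles on abelian varieties*, LNM 900 (1982), I.3.4, I.5 (p. 53),
  I Ex. 3.7 (c).
* [Gordon1999HodgeAVSurvey] B. B. Gordon, *A survey of the Hodge conjecture for abelian varieties*, §3 Theorem (Imai,
  Murty) with proof, 7.5–7.7, 9.4.3.
* [Lang2002] S. Lang, *Algebra*, 3rd ed., XVII §1, XVII §3.
* [Serre1977] J.-P. Serre, *Linear Representations of Finite Groups*, GTM 42, §2.6.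
* [Mai1989] L. Mai, *Lower bounds for the ranks of CM types*, J. Number Theory 32 (1989), §2 Prop. 1.
-/

set_option autoImplicit false

noncomputable section

open scoped BigOperators Classical

universe u u' u₀ u₁ uS v v' v'' vY w

namespace Summit.HodgeConjecture.CorCM.IrrOdd

open Literature.NumberTheory.ComplexMultiplication

variable {G : Type w} [Group G] {Y : Type vY} [MulAction G Y] [Fintype Y]

/-! ### §1 Preliminaries -/

section Prelim

variable {I : Type u} {E : I → Type v} [∀ i, MulAction G (E i)]

omit [MulAction G Y] [Fintype Y] in
/-- `⨆_i MC_i = ⨆_i S(u_i)`: every matrix-coefficient space is the shadow-coefficient space of its type vector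
`u_i = Σ_j ι^i_j(b^i_j)` on the Galois pivot (file K3, slot by slot). [cite: Deligne1982HodgeCycles, I.3.4] -/
theorem iSup_span_coeff_eq_iSup_span_shadowCoeff_of_eq (Φ : ∀ i, Set (E i)) {J : I → Type u₀} [∀ i, Fintype (J i)]
    (ι : ∀ i, J i → ((Y → ℚ) →ₗ[ℚ] (E i → ℚ))) (b : ∀ i, J i → (Y → ℚ))
    (hu : ∀ i, antiVec (Φ i) (1 : G) = ∑ j, ι i j (b i j)) :
    (⨆ i, Submodule.span ℚ (Set.range fun x : E i => fun g : G => antiVec (Φ i) g x)) =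
      ⨆ i, Submodule.span ℚ (Set.range fun x : E i => fun g : G => (∑ j, ι i j (b i j)) (g • x)) :=
  iSup_congr fun i => span_coeff_eq_span_shadowCoeff_of_eq Φ i (hu i)

end Prelim

/-- **FAMILY AGAINST FAMILY: `dim((⨆_s S(w_s)) ∩ (⨆_t S(w′_t)))·δ = dim((⨆_s D⟨b^s⟩) ∩ (⨆_t D⟨b′^t⟩))·dim A`**
(`A` stable irreducible with ANY commutant; two finite families of pivots; file S3 with the second family juxtaposed
on `⊔_t Y′_t`). [cite: Lang2002, XVII §3] [cite: Serre1977, §2.6] -/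
theorem finrank_iSup_span_shadowCoeff_inf_iSup_mul_eq {A : Submodule ℚ (Y → ℚ)}
    {𝒟 : Submodule ℚ ((Y → ℚ) →ₗ[ℚ] (Y → ℚ))}
    (h𝒟 : ∀ L : (Y → ℚ) →ₗ[ℚ] (Y → ℚ), L ∈ 𝒟 ↔ (∀ a ∈ A, L a ∈ A) ∧
      ∀ (k : G) (a : Y → ℚ), a ∈ A → L (fun y => a (k • y)) = fun y => L a (k • y))
    (hAst : ∀ (k : G) (a : Y → ℚ), a ∈ A → (fun y => a (k • y)) ∈ A)
    (hAirr : ∀ W : Submodule ℚ (Y → ℚ), W ≤ A → W ≠ ⊥ →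
      (∀ (k : G) (f : Y → ℚ), f ∈ W → (fun y => f (k • y)) ∈ W) → W = A)
    {S : Type uS} [Fintype S] {Yf : S → Type v'} [∀ s, MulAction G (Yf s)] [∀ s, Fintype (Yf s)]
    {Jf : S → Type u₀} [∀ s, Fintype (Jf s)] (ι : ∀ s, Jf s → ((Y → ℚ) →ₗ[ℚ] (Yf s → ℚ)))
    {S' : Type uS} [Fintype S'] {Yf' : S' → Type v''} [∀ t, MulAction G (Yf' t)] [∀ t, Fintype (Yf' t)]
    {Jf' : S' → Type u₁} [∀ t, Fintype (Jf' t)] (ι' : ∀ t, Jf' t → ((Y → ℚ) →ₗ[ℚ] (Yf' t → ℚ)))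
    (hιeq : ∀ s (j : Jf s) (k : G) (a : Y → ℚ), a ∈ A → ι s j (fun y => a (k • y)) = fun y => ι s j a (k • y))
    (hι'eq : ∀ t (j : Jf' t) (k : G) (a : Y → ℚ), a ∈ A → ι' t j (fun y => a (k • y)) = fun y => ι' t j a (k • y))
    (hind : ∀ s (f : Jf s → (Y → ℚ)), (∀ j, f j ∈ A) → ∑ j, ι s j (f j) = 0 → ∀ j, f j = 0)
    (hind' : ∀ t (f : Jf' t → (Y → ℚ)), (∀ j, f j ∈ A) → ∑ j, ι' t j (f j) = 0 → ∀ j, f j = 0)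
    {b : ∀ s, Jf s → (Y → ℚ)} {b' : ∀ t, Jf' t → (Y → ℚ)} (hb : ∀ s j, b s j ∈ A) (hb' : ∀ t j, b' t j ∈ A)
    {a₀ : Y → ℚ} (ha₀ : a₀ ∈ A) (h0 : a₀ ≠ 0) :
    Module.finrank ℚ
          ↥((⨆ s, Submodule.span ℚ (Set.range fun y : Yf s => fun g : G => (∑ j, ι s j (b s j)) (g • y))) ⊓
            ⨆ t, Submodule.span ℚ (Set.range fun y : Yf' t => fun g : G => (∑ j, ι' t j (b' t j)) (g • y))) *
        Module.finrank ℚ ↥(𝒟.map (LinearMap.applyₗ a₀)) =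
      Module.finrank ℚ ↥((⨆ s, ⨆ j, 𝒟.map (LinearMap.applyₗ (b s j))) ⊓ ⨆ t, ⨆ j, 𝒟.map (LinearMap.applyₗ (b' t j))) *
        Module.finrank ℚ A := by
  have h := finrank_iSup_span_shadowCoeff_inf_mul_eq (Y₁ := Σ t, Yf' t) (J₁ := Σ t, Jf' t) h𝒟 hAst hAirr ι
    (fun p => slotExt p.1 ∘ₗ ι' p.1 p.2) hιeq (fun p k a ha => slotExt_comp_apply_translate ι' hι'eq p k a ha) hind
    (fun f hf hf0 p => sigma_jointly_independent ι' hind' f hf hf0 p) hb (b₁ := fun p => b' p.1 p.2)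
    (fun p => hb' p.1 p.2) ha₀ h0
  rw [sum_sigma_slotExt_comp_apply, span_shadowCoeff_sigmaLift_eq_iSup, iSup_sigma_map_applyₗ] at h
  exact h

/-! ### §2 The Hodge group of the product of a family in one isotypic class -/

section Family

variable {I : Type u} {E : I → Type v} [∀ i, MulAction G (E i)] [∀ i, Fintype (E i)] [Fintype I]
  [∀ i, Nonempty (E i)]

/-- **THE HODGE GROUP OF THE PRODUCT IN ONE ISOTYPIC CLASS: `rank Σ·δ = δ + dim(⨆_i D⟨b^i⟩)·dim A`** (`dim Hg(∏_i A_i)·δ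
= dim(D-span of ALL the components)·dim A`; gen 56 F3's `dim U(Σ) = t·dim A` for slots of any shape, any commutant).
[cite: Mai1989, §2 Prop. 1 (proof)] [cite: Lang2002, XVII §3] [cite: Deligne1982HodgeCycles, I Ex. 3.7 (c)] -/
theorem typeRank_sigmaType_mul_eq_of_class [Nonempty I] {ρ : G} {Φ : ∀ i, Set (E i)}
    (h : ∀ i, IsCMTypeWith ρ (Φ i)) {A : Submodule ℚ (Y → ℚ)} {𝒟 : Submodule ℚ ((Y → ℚ) →ₗ[ℚ] (Y → ℚ))}
    (h𝒟 : ∀ L : (Y → ℚ) →ₗ[ℚ] (Y → ℚ), L ∈ 𝒟 ↔ (∀ a ∈ A, L a ∈ A) ∧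
      ∀ (k : G) (a : Y → ℚ), a ∈ A → L (fun y => a (k • y)) = fun y => L a (k • y))
    (hAst : ∀ (k : G) (a : Y → ℚ), a ∈ A → (fun y => a (k • y)) ∈ A)
    (hAirr : ∀ W : Submodule ℚ (Y → ℚ), W ≤ A → W ≠ ⊥ →
      (∀ (k : G) (f : Y → ℚ), f ∈ W → (fun y => f (k • y)) ∈ W) → W = A)
    {J : I → Type u₀} [∀ i, Fintype (J i)] (ι : ∀ i, J i → ((Y → ℚ) →ₗ[ℚ] (E i → ℚ)))
    (hιeq : ∀ i (j : J i) (k : G) (a : Y → ℚ), a ∈ A → ι i j (fun y => a (k • y)) = fun y => ι i j a (k • y))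
    (hind : ∀ i (f : J i → (Y → ℚ)), (∀ j, f j ∈ A) → ∑ j, ι i j (f j) = 0 → ∀ j, f j = 0)
    {b : ∀ i, J i → (Y → ℚ)} (hb : ∀ i j, b i j ∈ A) (hu : ∀ i, antiVec (Φ i) (1 : G) = ∑ j, ι i j (b i j))
    {a₀ : Y → ℚ} (ha₀ : a₀ ∈ A) (h0 : a₀ ≠ 0) :
    typeRank G (sigmaType Φ) * Module.finrank ℚ ↥(𝒟.map (LinearMap.applyₗ a₀)) =
      Module.finrank ℚ ↥(𝒟.map (LinearMap.applyₗ a₀)) +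
        Module.finrank ℚ ↥(⨆ i, ⨆ j, 𝒟.map (LinearMap.applyₗ (b i j))) * Module.finrank ℚ A := by
  obtain ⟨i₀⟩ := ‹Nonempty I›
  haveI : Nonempty (Σ i, E i) := ⟨⟨i₀, Classical.arbitrary (E i₀)⟩⟩
  rw [(IsCMTypeWith.sigmaType h).typeRank_eq_finrank_antiSpan_add_one,
    finrank_antiSpan_sigmaType_eq_finrank_iSup_span_coeff Φ, iSup_span_coeff_eq_iSup_span_shadowCoeff_of_eq Φ ι b hu,
    add_mul, one_mul, finrank_iSup_span_shadowCoeff_mul_eq (Yf := E) h𝒟 hAst hAirr ι hιeq hind hb ha₀ h0, add_comm]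

/-- **D-RANK FORM**: there is `r ≤ Σ_i |J_i|` with **`dim ⨆_i D⟨b^i⟩ = r·δ` and `rank Σ = r·dim A + 1`** —
`dim Hg(∏_i A_i) = r·dim A` with `r` the `D`-rank of all the components. [cite: Mai1989, §2 Prop. 1 (proof)]
[cite: Lang2002, XVII §3] [cite: Deligne1982HodgeCycles, I Ex. 3.7 (c)] -/
theorem exists_rank_typeRank_sigmaType_eq_of_class [Nonempty I] {ρ : G} {Φ : ∀ i, Set (E i)}
    (h : ∀ i, IsCMTypeWith ρ (Φ i)) {A : Submodule ℚ (Y → ℚ)} {𝒟 : Submodule ℚ ((Y → ℚ) →ₗ[ℚ] (Y → ℚ))}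
    (h𝒟 : ∀ L : (Y → ℚ) →ₗ[ℚ] (Y → ℚ), L ∈ 𝒟 ↔ (∀ a ∈ A, L a ∈ A) ∧
      ∀ (k : G) (a : Y → ℚ), a ∈ A → L (fun y => a (k • y)) = fun y => L a (k • y))
    (hAst : ∀ (k : G) (a : Y → ℚ), a ∈ A → (fun y => a (k • y)) ∈ A)
    (hAirr : ∀ W : Submodule ℚ (Y → ℚ), W ≤ A → W ≠ ⊥ →
      (∀ (k : G) (f : Y → ℚ), f ∈ W → (fun y => f (k • y)) ∈ W) → W = A)
    {J : I → Type u₀} [∀ i, Fintype (J i)] (ι : ∀ i, J i → ((Y → ℚ) →ₗ[ℚ] (E i → ℚ)))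
    (hιeq : ∀ i (j : J i) (k : G) (a : Y → ℚ), a ∈ A → ι i j (fun y => a (k • y)) = fun y => ι i j a (k • y))
    (hind : ∀ i (f : J i → (Y → ℚ)), (∀ j, f j ∈ A) → ∑ j, ι i j (f j) = 0 → ∀ j, f j = 0)
    {b : ∀ i, J i → (Y → ℚ)} (hb : ∀ i j, b i j ∈ A) (hu : ∀ i, antiVec (Φ i) (1 : G) = ∑ j, ι i j (b i j))
    {a₀ : Y → ℚ} (ha₀ : a₀ ∈ A) (h0 : a₀ ≠ 0) :
    ∃ r : ℕ, r ≤ ∑ i, Fintype.card (J i) ∧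
      Module.finrank ℚ ↥(⨆ i, ⨆ j, 𝒟.map (LinearMap.applyₗ (b i j))) =
        r * Module.finrank ℚ ↥(𝒟.map (LinearMap.applyₗ a₀)) ∧
      typeRank G (sigmaType Φ) = r * Module.finrank ℚ A + 1 := by
  obtain ⟨i₀⟩ := ‹Nonempty I›
  haveI : Nonempty (Σ i, E i) := ⟨⟨i₀, Classical.arbitrary (E i₀)⟩⟩
  obtain ⟨r, hr, hD, hS⟩ := exists_rank_finrank_iSup_span_shadowCoeff_eq (Yf := E) h𝒟 hAst hAirr ι hιeq hind hb
    ha₀ h0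
  refine ⟨r, hr, hD, ?_⟩
  rw [(IsCMTypeWith.sigmaType h).typeRank_eq_finrank_antiSpan_add_one,
    finrank_antiSpan_sigmaType_eq_finrank_iSup_span_coeff Φ, iSup_span_coeff_eq_iSup_span_shadowCoeff_of_eq Φ ι b hu,
    hS]

/-- **THE FAMILY DEFECT IN ONE ISOTYPIC CLASS: `(rank Σ + |I|)·δ + (Σ_i dim D⟨b^i⟩)·dim A = (Σ_i rank Φ_i + 1)·δ +
dim(⨆_i D⟨b^i⟩)·dim A`** — `(Σ_i dim Hg(A_i) − dim Hg(∏_i A_i))·δ = (Σ_i dim D⟨b^i⟩ − dim Σ_i D⟨b^i⟩)·dim A` (gen 64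
R1's defect, transported). [cite: Deligne1982HodgeCycles, I Ex. 3.7 (c)] [cite: Gordon1999HodgeAVSurvey, 7.5–7.7] -/
theorem typeRank_sigmaType_add_card_mul_add_eq_of_class [Nonempty I] {ρ : G} {Φ : ∀ i, Set (E i)}
    (h : ∀ i, IsCMTypeWith ρ (Φ i)) {A : Submodule ℚ (Y → ℚ)} {𝒟 : Submodule ℚ ((Y → ℚ) →ₗ[ℚ] (Y → ℚ))}
    (h𝒟 : ∀ L : (Y → ℚ) →ₗ[ℚ] (Y → ℚ), L ∈ 𝒟 ↔ (∀ a ∈ A, L a ∈ A) ∧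
      ∀ (k : G) (a : Y → ℚ), a ∈ A → L (fun y => a (k • y)) = fun y => L a (k • y))
    (hAst : ∀ (k : G) (a : Y → ℚ), a ∈ A → (fun y => a (k • y)) ∈ A)
    (hAirr : ∀ W : Submodule ℚ (Y → ℚ), W ≤ A → W ≠ ⊥ →
      (∀ (k : G) (f : Y → ℚ), f ∈ W → (fun y => f (k • y)) ∈ W) → W = A)
    {J : I → Type u₀} [∀ i, Fintype (J i)] (ι : ∀ i, J i → ((Y → ℚ) →ₗ[ℚ] (E i → ℚ)))
    (hιeq : ∀ i (j : J i) (k : G) (a : Y → ℚ), a ∈ A → ι i j (fun y => a (k • y)) = fun y => ι i j a (k • y))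
    (hind : ∀ i (f : J i → (Y → ℚ)), (∀ j, f j ∈ A) → ∑ j, ι i j (f j) = 0 → ∀ j, f j = 0)
    {b : ∀ i, J i → (Y → ℚ)} (hb : ∀ i j, b i j ∈ A) (hu : ∀ i, antiVec (Φ i) (1 : G) = ∑ j, ι i j (b i j))
    {a₀ : Y → ℚ} (ha₀ : a₀ ∈ A) (h0 : a₀ ≠ 0) :
    (typeRank G (sigmaType Φ) + Fintype.card I) * Module.finrank ℚ ↥(𝒟.map (LinearMap.applyₗ a₀)) +
        (∑ i, Module.finrank ℚ ↥(⨆ j, 𝒟.map (LinearMap.applyₗ (b i j)))) * Module.finrank ℚ A =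
      ((∑ i, typeRank G (Φ i)) + 1) * Module.finrank ℚ ↥(𝒟.map (LinearMap.applyₗ a₀)) +
        Module.finrank ℚ ↥(⨆ i, ⨆ j, 𝒟.map (LinearMap.applyₗ (b i j))) * Module.finrank ℚ A := by
  have hdef := typeRank_sigmaType_add_card_add_sum_finrank_eq h
  rw [iSup_span_coeff_eq_iSup_span_shadowCoeff_of_eq Φ ι b hu,
    Finset.sum_congr rfl fun i _ => congrArg (fun W : Submodule ℚ (G → ℚ) => Module.finrank ℚ ↥W)
      (span_coeff_eq_span_shadowCoeff_of_eq Φ i (hu i))] at hdef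
  have hfam := finrank_iSup_span_shadowCoeff_mul_eq (Yf := E) h𝒟 hAst hAirr ι hιeq hind hb ha₀ h0
  have hone : ∀ i, Module.finrank ℚ ↥(Submodule.span ℚ (Set.range fun x : E i => fun g : G =>
      (∑ j, ι i j (b i j)) (g • x))) * Module.finrank ℚ ↥(𝒟.map (LinearMap.applyₗ a₀)) =
        Module.finrank ℚ ↥(⨆ j, 𝒟.map (LinearMap.applyₗ (b i j))) * Module.finrank ℚ A :=
    fun i => finrank_span_shadowCoeff_sum_mul_eq (Y₀ := E i) h𝒟 hAst hAirr (ι i) (hιeq i) (hind i) (hb i) ha₀ h0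
  have hsum : (∑ i, Module.finrank ℚ ↥(Submodule.span ℚ (Set.range fun x : E i => fun g : G =>
      (∑ j, ι i j (b i j)) (g • x)))) * Module.finrank ℚ ↥(𝒟.map (LinearMap.applyₗ a₀)) =
        (∑ i, Module.finrank ℚ ↥(⨆ j, 𝒟.map (LinearMap.applyₗ (b i j)))) * Module.finrank ℚ A := by
    rw [Finset.sum_mul, Finset.sum_mul]
    exact Finset.sum_congr rfl fun i _ => hone i
  have key := congrArg (· * Module.finrank ℚ ↥(𝒟.map (LinearMap.applyₗ a₀))) hdef
  simp only [add_mul] at key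
  rw [hsum, hfam] at key
  linarith [key]

/-- **ADDITIVITY IN ONE ISOTYPIC CLASS: `Hg(∏_i A_i) = ∏_i Hg(A_i)` (`rank Σ + |I| = Σ_i rank Φ_i + 1`) IFF the
D-spans `D⟨b^i⟩ ≤ A` of the type components are INDEPENDENT** (gen 64 R1's «`MC_i` independent», read inside `A` over
the commutant). [cite: Gordon1999HodgeAVSurvey, §3 Theorem and 7.5–7.7] [cite: Lang2002, XVII §1 and §3] -/
theorem typeRank_sigmaType_add_card_eq_iff_iSupIndep_of_class [Nonempty I] {ρ : G} {Φ : ∀ i, Set (E i)}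
    (h : ∀ i, IsCMTypeWith ρ (Φ i)) {A : Submodule ℚ (Y → ℚ)} {𝒟 : Submodule ℚ ((Y → ℚ) →ₗ[ℚ] (Y → ℚ))}
    (h𝒟 : ∀ L : (Y → ℚ) →ₗ[ℚ] (Y → ℚ), L ∈ 𝒟 ↔ (∀ a ∈ A, L a ∈ A) ∧
      ∀ (k : G) (a : Y → ℚ), a ∈ A → L (fun y => a (k • y)) = fun y => L a (k • y))
    (hAst : ∀ (k : G) (a : Y → ℚ), a ∈ A → (fun y => a (k • y)) ∈ A)
    (hAirr : ∀ W : Submodule ℚ (Y → ℚ), W ≤ A → W ≠ ⊥ →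
      (∀ (k : G) (f : Y → ℚ), f ∈ W → (fun y => f (k • y)) ∈ W) → W = A)
    (hA0 : A ≠ ⊥) {J : I → Type u₀} [∀ i, Fintype (J i)] (ι : ∀ i, J i → ((Y → ℚ) →ₗ[ℚ] (E i → ℚ)))
    (hιeq : ∀ i (j : J i) (k : G) (a : Y → ℚ), a ∈ A → ι i j (fun y => a (k • y)) = fun y => ι i j a (k • y))
    (hind : ∀ i (f : J i → (Y → ℚ)), (∀ j, f j ∈ A) → ∑ j, ι i j (f j) = 0 → ∀ j, f j = 0)
    {b : ∀ i, J i → (Y → ℚ)} (hb : ∀ i j, b i j ∈ A) (hu : ∀ i, antiVec (Φ i) (1 : G) = ∑ j, ι i j (b i j)) :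
    typeRank G (sigmaType Φ) + Fintype.card I = (∑ i, typeRank G (Φ i)) + 1 ↔
      iSupIndep fun i => ⨆ j, 𝒟.map (LinearMap.applyₗ (b i j)) := by
  obtain ⟨a₀, ha₀, h0⟩ := Submodule.exists_mem_ne_zero_of_ne_bot hA0
  have hdef := typeRank_sigmaType_add_card_mul_add_eq_of_class h h𝒟 hAst hAirr ι hιeq hind hb hu ha₀ h0
  let T : G → (Y → ℚ) →ₗ[ℚ] (Y → ℚ) := fun k => LinearMap.funLeft ℚ ℚ (fun y : Y => k • y)
  haveI : FiniteDimensional ℚ A := Submodule.finiteDimensional_of_le le_top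
  have hA : 0 < Module.finrank ℚ A :=
    Nat.pos_of_ne_zero fun h' => hA0 (Submodule.finrank_eq_zero.1 h')
  haveI : FiniteDimensional ℚ ↥(𝒟.map (LinearMap.applyₗ a₀)) :=
    Submodule.finiteDimensional_of_le (map_applyₗ_le T (A := A) (fun L => h𝒟 L) ha₀)
  have hδ : 0 < Module.finrank ℚ ↥(𝒟.map (LinearMap.applyₗ a₀)) :=
    Nat.pos_of_ne_zero fun h' => map_applyₗ_ne_bot T (A := A) (fun L => h𝒟 L) h0 (Submodule.finrank_eq_zero.1 h')
  haveI : ∀ i, Module.Finite ℚ ↥(⨆ j, 𝒟.map (LinearMap.applyₗ (b i j))) := fun i =>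
    Submodule.finiteDimensional_of_le (iSup_map_applyₗ_le T (A := A) (fun L => h𝒟 L) (hb i))
  rw [← finrank_iSup_eq_sum_finrank_iff_iSupIndep]
  set δ := Module.finrank ℚ ↥(𝒟.map (LinearMap.applyₗ a₀)) with hδdef
  set dA := Module.finrank ℚ A with hdA
  set DI := Module.finrank ℚ ↥(⨆ i, ⨆ j, 𝒟.map (LinearMap.applyₗ (b i j))) with hDI
  set DS := ∑ i, Module.finrank ℚ ↥(⨆ j, 𝒟.map (LinearMap.applyₗ (b i j))) with hDS
  constructor
  · intro hadd
    rw [hadd] at hdef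
    have hmul : DS * dA = DI * dA := by linarith [hdef]
    exact (Nat.eq_of_mul_eq_mul_right hA hmul).symm
  · intro hind'
    rw [hind'] at hdef
    have hmul : (typeRank G (sigmaType Φ) + Fintype.card I) * δ = ((∑ i, typeRank G (Φ i)) + 1) * δ := by
      linarith [hdef]
    exact Nat.eq_of_mul_eq_mul_right hδ hmul

/-! ### §3 Sub-families in one isotypic class -/

/-- **SUB-FAMILY DOMINATION IN ONE ISOTYPIC CLASS: `rank Σ = rank Σ_κ ⟺ ∀ i, D⟨b^i⟩ ≤ ⨆_j D⟨b^{κ j}⟩`** (`A ≠ 0`,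
`κ : I′ → I`): every member is Hodge-dominated by the sub-product iff its components are `D`-combinations of the kept
ones. [cite: Deligne1982HodgeCycles, I.5 (p. 53)] [cite: Gordon1999HodgeAVSurvey, 7.5–7.7] [cite: Lang2002, XVII §3] -/
theorem typeRank_sigmaType_eq_reindex_iff_forall_iSup_le_of_class {ρ : G} {Φ : ∀ i, Set (E i)}
    (h : ∀ i, IsCMTypeWith ρ (Φ i)) {I' : Type u'} [Fintype I'] (κ : I' → I) [Nonempty I']
    {A : Submodule ℚ (Y → ℚ)} {𝒟 : Submodule ℚ ((Y → ℚ) →ₗ[ℚ] (Y → ℚ))}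
    (h𝒟 : ∀ L : (Y → ℚ) →ₗ[ℚ] (Y → ℚ), L ∈ 𝒟 ↔ (∀ a ∈ A, L a ∈ A) ∧
      ∀ (k : G) (a : Y → ℚ), a ∈ A → L (fun y => a (k • y)) = fun y => L a (k • y))
    (hAst : ∀ (k : G) (a : Y → ℚ), a ∈ A → (fun y => a (k • y)) ∈ A)
    (hAirr : ∀ W : Submodule ℚ (Y → ℚ), W ≤ A → W ≠ ⊥ →
      (∀ (k : G) (f : Y → ℚ), f ∈ W → (fun y => f (k • y)) ∈ W) → W = A)
    (hA0 : A ≠ ⊥) {J : I → Type u₀} [∀ i, Fintype (J i)] (ι : ∀ i, J i → ((Y → ℚ) →ₗ[ℚ] (E i → ℚ)))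
    (hιeq : ∀ i (j : J i) (k : G) (a : Y → ℚ), a ∈ A → ι i j (fun y => a (k • y)) = fun y => ι i j a (k • y))
    (hind : ∀ i (f : J i → (Y → ℚ)), (∀ j, f j ∈ A) → ∑ j, ι i j (f j) = 0 → ∀ j, f j = 0)
    {b : ∀ i, J i → (Y → ℚ)} (hb : ∀ i j, b i j ∈ A) (hu : ∀ i, antiVec (Φ i) (1 : G) = ∑ j, ι i j (b i j)) :
    typeRank G (sigmaType Φ) = typeRank G (sigmaType fun j => Φ (κ j)) ↔
      ∀ i, (⨆ j, 𝒟.map (LinearMap.applyₗ (b i j))) ≤ ⨆ j', ⨆ j, 𝒟.map (LinearMap.applyₗ (b (κ j') j)) := by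
  obtain ⟨j₀⟩ := ‹Nonempty I'›
  haveI : Nonempty (Σ j, E (κ j)) := ⟨⟨j₀, Classical.arbitrary (E (κ j₀))⟩⟩
  rw [typeRank_sigmaType_eq_reindex_iff_forall_span_coeff_le h κ]
  refine forall_congr' fun i => ?_
  rw [span_coeff_eq_span_shadowCoeff_of_eq Φ i (hu i),
    iSup_span_coeff_eq_iSup_span_shadowCoeff_of_eq (E := fun j => E (κ j)) (fun j => Φ (κ j)) (fun j => ι (κ j))
      (fun j => b (κ j)) fun j => hu (κ j)]
  exact span_shadowCoeff_le_iSup_iff_iSup_le (Yf := fun j => E (κ j)) h𝒟 hAst hAirr hA0 (fun j => ι (κ j)) (ι i)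
    (fun j => hιeq (κ j)) (hιeq i) (fun j => hind (κ j)) (hind i) (fun j => hb (κ j)) (hb i)

/-- **`rank Σ = rank Σ_κ ⟺ ⨆_i D⟨b^i⟩ = ⨆_j D⟨b^{κ j}⟩`** (equality of the total D-spans; here the index types `I`,
`I′` live in one universe, as in file S3's family-against-family comparison).
[cite: Deligne1982HodgeCycles, I.5 (p. 53)] [cite: Lang2002, XVII §3] -/
theorem typeRank_sigmaType_eq_reindex_iff_iSup_eq_of_class {ρ : G} {Φ : ∀ i, Set (E i)}
    (h : ∀ i, IsCMTypeWith ρ (Φ i)) {I' : Type u} [Fintype I'] (κ : I' → I) [Nonempty I']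
    {A : Submodule ℚ (Y → ℚ)} {𝒟 : Submodule ℚ ((Y → ℚ) →ₗ[ℚ] (Y → ℚ))}
    (h𝒟 : ∀ L : (Y → ℚ) →ₗ[ℚ] (Y → ℚ), L ∈ 𝒟 ↔ (∀ a ∈ A, L a ∈ A) ∧
      ∀ (k : G) (a : Y → ℚ), a ∈ A → L (fun y => a (k • y)) = fun y => L a (k • y))
    (hAst : ∀ (k : G) (a : Y → ℚ), a ∈ A → (fun y => a (k • y)) ∈ A)
    (hAirr : ∀ W : Submodule ℚ (Y → ℚ), W ≤ A → W ≠ ⊥ →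
      (∀ (k : G) (f : Y → ℚ), f ∈ W → (fun y => f (k • y)) ∈ W) → W = A)
    (hA0 : A ≠ ⊥) {J : I → Type u₀} [∀ i, Fintype (J i)] (ι : ∀ i, J i → ((Y → ℚ) →ₗ[ℚ] (E i → ℚ)))
    (hιeq : ∀ i (j : J i) (k : G) (a : Y → ℚ), a ∈ A → ι i j (fun y => a (k • y)) = fun y => ι i j a (k • y))
    (hind : ∀ i (f : J i → (Y → ℚ)), (∀ j, f j ∈ A) → ∑ j, ι i j (f j) = 0 → ∀ j, f j = 0)
    {b : ∀ i, J i → (Y → ℚ)} (hb : ∀ i j, b i j ∈ A) (hu : ∀ i, antiVec (Φ i) (1 : G) = ∑ j, ι i j (b i j)) :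
    typeRank G (sigmaType Φ) = typeRank G (sigmaType fun j => Φ (κ j)) ↔
      (⨆ j', ⨆ j, 𝒟.map (LinearMap.applyₗ (b (κ j') j))) = ⨆ i, ⨆ j, 𝒟.map (LinearMap.applyₗ (b i j)) := by
  obtain ⟨j₀⟩ := ‹Nonempty I'›
  haveI : Nonempty (Σ j, E (κ j)) := ⟨⟨j₀, Classical.arbitrary (E (κ j₀))⟩⟩
  rw [typeRank_sigmaType_eq_reindex_iff_iSup_span_coeff_eq h κ, iSup_span_coeff_eq_iSup_span_shadowCoeff_of_eq Φ ι b hu,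
    iSup_span_coeff_eq_iSup_span_shadowCoeff_of_eq (E := fun j => E (κ j)) (fun j => Φ (κ j)) (fun j => ι (κ j))
      (fun j => b (κ j)) fun j => hu (κ j)]
  exact iSup_span_shadowCoeff_eq_iSup_iff (Yf := E) (Yf' := fun j => E (κ j)) (Jf' := fun j => J (κ j)) h𝒟 hAst
    hAirr hA0 ι (fun j => ι (κ j)) hιeq (fun j => hιeq (κ j)) hind (fun j => hind (κ j)) (b' := fun j => b (κ j)) hb
    fun j => hb (κ j)

/-- **THE REINDEXING EXCESS IN A CLASS: `rank Σ_κ·δ + dim(⨆_i D⟨b^i⟩)·dim A = rank Σ·δ + dim(⨆_j D⟨b^{κ j}⟩)·dim A`**,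
i.e. `(dim Hg(∏_I A_i) − dim Hg(∏_{I′} A_{κ j}))·δ = (dim ⨆_I D⟨b^i⟩ − dim ⨆_{I′} D⟨b^{κ j}⟩)·dim A`.
[cite: Deligne1982HodgeCycles, I.5 (p. 53)] [cite: Lang2002, XVII §3] -/
theorem typeRank_sigmaType_reindex_mul_add_eq_of_class [Nonempty I] {ρ : G} {Φ : ∀ i, Set (E i)}
    (h : ∀ i, IsCMTypeWith ρ (Φ i)) {I' : Type u'} [Fintype I'] (κ : I' → I) [Nonempty I']
    {A : Submodule ℚ (Y → ℚ)} {𝒟 : Submodule ℚ ((Y → ℚ) →ₗ[ℚ] (Y → ℚ))}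
    (h𝒟 : ∀ L : (Y → ℚ) →ₗ[ℚ] (Y → ℚ), L ∈ 𝒟 ↔ (∀ a ∈ A, L a ∈ A) ∧
      ∀ (k : G) (a : Y → ℚ), a ∈ A → L (fun y => a (k • y)) = fun y => L a (k • y))
    (hAst : ∀ (k : G) (a : Y → ℚ), a ∈ A → (fun y => a (k • y)) ∈ A)
    (hAirr : ∀ W : Submodule ℚ (Y → ℚ), W ≤ A → W ≠ ⊥ →
      (∀ (k : G) (f : Y → ℚ), f ∈ W → (fun y => f (k • y)) ∈ W) → W = A)
    {J : I → Type u₀} [∀ i, Fintype (J i)] (ι : ∀ i, J i → ((Y → ℚ) →ₗ[ℚ] (E i → ℚ)))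
    (hιeq : ∀ i (j : J i) (k : G) (a : Y → ℚ), a ∈ A → ι i j (fun y => a (k • y)) = fun y => ι i j a (k • y))
    (hind : ∀ i (f : J i → (Y → ℚ)), (∀ j, f j ∈ A) → ∑ j, ι i j (f j) = 0 → ∀ j, f j = 0)
    {b : ∀ i, J i → (Y → ℚ)} (hb : ∀ i j, b i j ∈ A) (hu : ∀ i, antiVec (Φ i) (1 : G) = ∑ j, ι i j (b i j))
    {a₀ : Y → ℚ} (ha₀ : a₀ ∈ A) (h0 : a₀ ≠ 0) :
    typeRank G (sigmaType fun j => Φ (κ j)) * Module.finrank ℚ ↥(𝒟.map (LinearMap.applyₗ a₀)) +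
        Module.finrank ℚ ↥(⨆ i, ⨆ j, 𝒟.map (LinearMap.applyₗ (b i j))) * Module.finrank ℚ A =
      typeRank G (sigmaType Φ) * Module.finrank ℚ ↥(𝒟.map (LinearMap.applyₗ a₀)) +
        Module.finrank ℚ ↥(⨆ j', ⨆ j, 𝒟.map (LinearMap.applyₗ (b (κ j') j))) * Module.finrank ℚ A := by
  have hI := typeRank_sigmaType_mul_eq_of_class h h𝒟 hAst hAirr ι hιeq hind hb hu ha₀ h0
  have hI' := typeRank_sigmaType_mul_eq_of_class (E := fun j => E (κ j)) (Φ := fun j => Φ (κ j)) (fun j => h (κ j))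
    h𝒟 hAst hAirr (fun j => ι (κ j)) (fun j => hιeq (κ j)) (fun j => hind (κ j)) (fun j => hb (κ j))
    (fun j => hu (κ j)) ha₀ h0
  rw [hI, hI']
  ring

/-- **TWO BLOCKS IN A CLASS: `(rank Σ|_p + rank Σ|_q)·δ = (rank Σ|_{p∨q} + 1)·δ + dim((⨆_p D⟨b^i⟩) ∩ (⨆_q D⟨b^i⟩))·dim A`**
(file S1's exact two-block defect `dim(MC_p ∩ MC_q)`, read in the class). [cite: Deligne1982HodgeCycles, I.5 (p. 53)]
[cite: Gordon1999HodgeAVSurvey, §3 Theorem (proof), 7.5–7.7] [cite: Lang2002, XVII §3] -/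
theorem typeRank_sigmaType_add_mul_eq_of_union_of_class {ρ : G} {Φ : ∀ i, Set (E i)}
    (h : ∀ i, IsCMTypeWith ρ (Φ i)) (p q r : I → Prop) (hr : ∀ i, r i ↔ p i ∨ q i)
    [Nonempty {i // p i}] [Nonempty {i // q i}]
    {A : Submodule ℚ (Y → ℚ)} {𝒟 : Submodule ℚ ((Y → ℚ) →ₗ[ℚ] (Y → ℚ))}
    (h𝒟 : ∀ L : (Y → ℚ) →ₗ[ℚ] (Y → ℚ), L ∈ 𝒟 ↔ (∀ a ∈ A, L a ∈ A) ∧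
      ∀ (k : G) (a : Y → ℚ), a ∈ A → L (fun y => a (k • y)) = fun y => L a (k • y))
    (hAst : ∀ (k : G) (a : Y → ℚ), a ∈ A → (fun y => a (k • y)) ∈ A)
    (hAirr : ∀ W : Submodule ℚ (Y → ℚ), W ≤ A → W ≠ ⊥ →
      (∀ (k : G) (f : Y → ℚ), f ∈ W → (fun y => f (k • y)) ∈ W) → W = A)
    {J : I → Type u₀} [∀ i, Fintype (J i)] (ι : ∀ i, J i → ((Y → ℚ) →ₗ[ℚ] (E i → ℚ)))
    (hιeq : ∀ i (j : J i) (k : G) (a : Y → ℚ), a ∈ A → ι i j (fun y => a (k • y)) = fun y => ι i j a (k • y))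
    (hind : ∀ i (f : J i → (Y → ℚ)), (∀ j, f j ∈ A) → ∑ j, ι i j (f j) = 0 → ∀ j, f j = 0)
    {b : ∀ i, J i → (Y → ℚ)} (hb : ∀ i j, b i j ∈ A) (hu : ∀ i, antiVec (Φ i) (1 : G) = ∑ j, ι i j (b i j))
    {a₀ : Y → ℚ} (ha₀ : a₀ ∈ A) (h0 : a₀ ≠ 0) :
    (typeRank G (sigmaType fun j : {i // p i} => Φ j.1) + typeRank G (sigmaType fun j : {i // q i} => Φ j.1)) *
        Module.finrank ℚ ↥(𝒟.map (LinearMap.applyₗ a₀)) =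
      (typeRank G (sigmaType fun j : {i // r i} => Φ j.1) + 1) * Module.finrank ℚ ↥(𝒟.map (LinearMap.applyₗ a₀)) +
        Module.finrank ℚ ↥((⨆ j : {i // p i}, ⨆ k, 𝒟.map (LinearMap.applyₗ (b j.1 k))) ⊓
            ⨆ j : {i // q i}, ⨆ k, 𝒟.map (LinearMap.applyₗ (b j.1 k))) * Module.finrank ℚ A := by
  obtain ⟨⟨i₁, hi₁⟩⟩ := ‹Nonempty {i // p i}›
  obtain ⟨⟨i₂, hi₂⟩⟩ := ‹Nonempty {i // q i}›
  haveI : Nonempty (Σ j : {i // p i}, E j.1) := ⟨⟨⟨i₁, hi₁⟩, Classical.arbitrary (E i₁)⟩⟩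
  haveI : Nonempty (Σ j : {i // q i}, E j.1) := ⟨⟨⟨i₂, hi₂⟩, Classical.arbitrary (E i₂)⟩⟩
  have hblock := typeRank_sigmaType_add_typeRank_sigmaType_eq_of_union h p q r hr
  rw [iSup_span_coeff_eq_iSup_span_shadowCoeff_of_eq (E := fun j : {i // p i} => E j.1) (fun j => Φ j.1)
      (fun j => ι j.1) (fun j => b j.1) fun j => hu j.1,
    iSup_span_coeff_eq_iSup_span_shadowCoeff_of_eq (E := fun j : {i // q i} => E j.1) (fun j => Φ j.1)
      (fun j => ι j.1) (fun j => b j.1) fun j => hu j.1] at hblock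
  have hmeet := finrank_iSup_span_shadowCoeff_inf_iSup_mul_eq (Yf := fun j : {i // p i} => E j.1)
    (Yf' := fun j : {i // q i} => E j.1) h𝒟 hAst hAirr (fun j => ι j.1) (fun j => ι j.1) (fun j => hιeq j.1)
    (fun j => hιeq j.1) (fun j => hind j.1) (fun j => hind j.1) (fun j => hb j.1) (fun j => hb j.1) ha₀ h0
  have key := congrArg (· * Module.finrank ℚ ↥(𝒟.map (LinearMap.applyₗ a₀))) hblock
  simp only [add_mul] at key
  rw [hmeet] at key
  linarith [key]

/-- **ALL BUT ONE IN A CLASS: `rank Σ = rank Σ|_{≠ i₀} ⟺ D⟨b^{i₀}⟩ ≤ ⨆_{i ≠ i₀} D⟨b^i⟩`** (`A ≠ 0`): `A_{i₀}` is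
Hodge-dominated by the product of the others iff its components are `D`-combinations of theirs.
[cite: Deligne1982HodgeCycles, I.5 (p. 53)] [cite: Gordon1999HodgeAVSurvey, 7.5–7.7] [cite: Lang2002, XVII §3] -/
theorem typeRank_sigmaType_eq_iff_iSup_le_of_erase_of_class {ρ : G} {Φ : ∀ i, Set (E i)}
    (h : ∀ i, IsCMTypeWith ρ (Φ i)) (i₀ : I) [Nonempty {i // i ≠ i₀}]
    {A : Submodule ℚ (Y → ℚ)} {𝒟 : Submodule ℚ ((Y → ℚ) →ₗ[ℚ] (Y → ℚ))}
    (h𝒟 : ∀ L : (Y → ℚ) →ₗ[ℚ] (Y → ℚ), L ∈ 𝒟 ↔ (∀ a ∈ A, L a ∈ A) ∧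
      ∀ (k : G) (a : Y → ℚ), a ∈ A → L (fun y => a (k • y)) = fun y => L a (k • y))
    (hAst : ∀ (k : G) (a : Y → ℚ), a ∈ A → (fun y => a (k • y)) ∈ A)
    (hAirr : ∀ W : Submodule ℚ (Y → ℚ), W ≤ A → W ≠ ⊥ →
      (∀ (k : G) (f : Y → ℚ), f ∈ W → (fun y => f (k • y)) ∈ W) → W = A)
    (hA0 : A ≠ ⊥) {J : I → Type u₀} [∀ i, Fintype (J i)] (ι : ∀ i, J i → ((Y → ℚ) →ₗ[ℚ] (E i → ℚ)))
    (hιeq : ∀ i (j : J i) (k : G) (a : Y → ℚ), a ∈ A → ι i j (fun y => a (k • y)) = fun y => ι i j a (k • y))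
    (hind : ∀ i (f : J i → (Y → ℚ)), (∀ j, f j ∈ A) → ∑ j, ι i j (f j) = 0 → ∀ j, f j = 0)
    {b : ∀ i, J i → (Y → ℚ)} (hb : ∀ i j, b i j ∈ A) (hu : ∀ i, antiVec (Φ i) (1 : G) = ∑ j, ι i j (b i j)) :
    typeRank G (sigmaType Φ) = typeRank G (sigmaType fun j : {i // i ≠ i₀} => Φ j.1) ↔
      (⨆ j, 𝒟.map (LinearMap.applyₗ (b i₀ j))) ≤
        ⨆ j : {i // i ≠ i₀}, ⨆ k, 𝒟.map (LinearMap.applyₗ (b j.1 k)) := by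
  obtain ⟨⟨i₁, hi₁⟩⟩ := ‹Nonempty {i // i ≠ i₀}›
  haveI : Nonempty (Σ j : {i // i ≠ i₀}, E j.1) := ⟨⟨⟨i₁, hi₁⟩, Classical.arbitrary (E i₁)⟩⟩
  rw [typeRank_sigmaType_eq_iff_span_coeff_le_of_erase h i₀, span_coeff_eq_span_shadowCoeff_of_eq Φ i₀ (hu i₀),
    iSup_span_coeff_eq_iSup_span_shadowCoeff_of_eq (E := fun j : {i // i ≠ i₀} => E j.1) (fun j => Φ j.1)
      (fun j => ι j.1) (fun j => b j.1) fun j => hu j.1]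
  exact span_shadowCoeff_le_iSup_iff_iSup_le (Yf := fun j : {i // i ≠ i₀} => E j.1) h𝒟 hAst hAirr hA0
    (fun j => ι j.1) (ι i₀) (fun j => hιeq j.1) (hιeq i₀) (fun j => hind j.1) (hind i₀) (fun j => hb j.1) (hb i₀)

end Family

end Summit.HodgeConjecture.CorCM.IrrOdd

end
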